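import Summits.AtomisticToContinuum.FouriersLaw.Theorems.BondHeatUncertaintyExtensiveSnapshotIrreversibilityEnergyWindowSkeletonGramFloor
import HarnessLib

/-!
# Bond heat uncertainty — node «SkeletonGramLimit»: the measurable Gram floor `λ_min(Γ_m)`,
  its monotone limit, the limit currency (MC∞), and the sandwich (MC⁰) ⇒ (MC∞) ⇒ (MC⁰_κ)

Cell `decomp-a2c`, lens «grading / quantitative ladder», generation 83, part B of the node
«SkeletonGramFloor» (part A: `…EnergyWindowSkeletonGramFloor`, the statements (MC⁰)/(MC⁰_κ)
and their harmonic calibration).  This part makes the smallest eigenvalue of the skeleton Gram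
matrix `Γ_m = skelGramPath … s m z wp` a MEASURABLE function of the path without any spectral
theory — as the infimum of Rayleigh quotients over the countably many nonzero RATIONAL directions
(`skelGramFloor`; a frame bound for every real direction by density and closedness) — and passes
to the monotone limit `L = sup_m λ_min(Γ_m)⁺ ∈ [0, ∞]` (`skelGramLimitFloor`; the `Γ_m` increase
in the Loewner order along the path, part S).

§1 `ratVec`, `RatDir`, `skelRayleigh`, `skelGramFloor`, `skelGramLimitFloor` (defs) and their
  calculus (proved): nonnegativity, `le_skelGramFloor` (a frame constant is below the floor),
  `skelGramFloor_frame` (the floor IS a frame constant: `F |a|² ≤ aᵀΓ_m a` for all real `a`),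
  `skelGramFloor_mono` (monotone in the level), `measurable_skelGramFloor`,
  `measurable_skelGramLimitFloor`.
§2 (MC∞) `SkeletonGramLimitInverseMoments(Body)`: `E[L^{-q}] ≤ (C e^{εH(z)})^q` for the limit
  floor `L(z, wp)` (integrand `L⁻¹ ^ q` in `ℝ≥0∞`: `L = 0` gives `⊤`, no junk escape), every
  `q < ∞`, every `ε > 0`, `s ∈ [½, 1]` fixed, `|δ| < δ₀` — no level, no minorant, no `κ` in the
  statement: the inverse moments of (the monotone approximation from below of) the smallest
  eigenvalue of the Malliavin matrix at time `s`, with sub-exponential energy growth.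
§3 THE SANDWICH (proved): `skeletonGramLimitInverseMomentsBody_of_body` (MC⁰) ⇒ (MC∞) (a frame
  minorant serving all large levels is below the limit floor) and
  `skeletonGramInverseMomentsRegBody_of_limit` (MC∞) ⇒ (MC⁰_κ) with constant `C + 1` (for
  `κ > 0` the functions `(F_m + κ)^{-q} ≤ κ^{-q}` decrease in `m` to `(sup_m (F_m + κ))^{-q} ≤
  L^{-q}`; `lintegral_iInf` = dominated convergence gives a level `m₁` with
  `E[(F_{m₁} + κ)^{-q}] < ((C+1)e^{εH})^q`, and `Λ = F_{m₁} + κ` is a measurable frame minorant of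
  every `Γ_m + κ`, `m ≥ m₁`, by monotonicity).  Hence the harmonic calibration of (MC∞)
  (`harmonic_skeletonGramLimitInverseMomentsBody`, from part A).  So (MC∞) is the natural BINDER
  beneath (MD₂): it is implied by the critic's (MC⁰), implies the consumable (MC⁰_κ), needs no
  finite-level integrability, and is literally a statement about the limiting Malliavin matrix.
NOT HERE: the identification of `L` with `λ_min` of the Malliavin matrix `⟨DX_s, DX_s⟩`
(additive noise: `Γ_m = A P_m A*` with `P_m ↑ 1` the dyadic projections of the Cameron–Martin
space — first support lemma of the anharmonic discharge, critic (g3)); the anharmonic (MC∞).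
No new instance / notation; no proof holes.  References: D. Nualart, *The Malliavin Calculus and
Related Topics* (2006) §2.3 Lemma 2.3.1; M. Hairer, J. Mattingly, Electron. J. Probab. 16 (2011)
Thm 6.7.
-/

noncomputable section

namespace Summit.AtomisticToContinuum.FouriersLaw.Theorems.ExtensiveSnapshotIrreversibility.EnergyWindow

open MeasureTheory ProbabilityTheory Filter Topology Set
open scoped ENNReal NNReal Matrix
open Literature.MathematicalPhysics.KineticTheory.HeatConduction Literature.Probability.Process

/-! ## 1. The countable Rayleigh floor and its monotone limit -/

section Floor

/-- Rational coefficient vectors, cast to real ones. [folklore] -/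
def ratVec (N : ℕ) : (Fin N ⊕ Fin N → ℚ) → (Fin N ⊕ Fin N → ℝ) :=
  Pi.map fun _ => ((↑) : ℚ → ℝ)

/-- The nonzero rational coefficient vectors: a countable dense set of directions. [folklore] -/
abbrev RatDir (N : ℕ) : Type := {a : Fin N ⊕ Fin N → ℚ // a ≠ 0}

/-- `denseRange_ratVec` (docstring added by the landing lane; see the module docstring). [formal bookkeeping] -/
theorem denseRange_ratVec (N : ℕ) : DenseRange (ratVec N) :=
  DenseRange.piMap fun _ => Rat.denseRange_cast

/-- `ratVec_zero` (docstring added by the landing lane; see the module docstring). [formal bookkeeping] -/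
theorem ratVec_zero (N : ℕ) : ratVec N 0 = 0 := by
  funext c
  simp [ratVec]

/-- `ratVec_dotProduct_self_pos` (docstring added by the landing lane; see the module docstring). [formal bookkeeping] -/
theorem ratVec_dotProduct_self_pos {N : ℕ} (a : RatDir N) : 0 < ratVec N a.1 ⬝ᵥ ratVec N a.1 := by
  obtain ⟨c, hc⟩ := Function.ne_iff.1 a.2
  have hc' : ratVec N a.1 c ≠ 0 := by simpa [ratVec] using hc
  exact lt_of_lt_of_le (by positivity) (sq_apply_le_dotProduct (ratVec N a.1) c)

/-- `nonempty_ratDir` (docstring added by the landing lane; see the module docstring). [formal bookkeeping] -/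
theorem nonempty_ratDir {N : ℕ} (hN : 0 < N) : Nonempty (RatDir N) :=
  ⟨⟨fun _ => 1, fun h => one_ne_zero (congr_fun h (Sum.inl ⟨0, hN⟩))⟩⟩

variable (ω₂ lam β γ : ℝ) (N : ℕ) (T_L T_R s : ℝ)

/-- The Rayleigh quotient `aᵀΓ_m a / |a|²` of the skeleton Gram matrix along the path at a
nonzero rational direction `a`. [folklore] -/
def skelRayleigh (m : ℕ) (z : PhaseSpace N) (wp : WienerPair) (a : RatDir N) : ℝ :=
  ratVec N a.1 ⬝ᵥ (skelGramPath ω₂ lam β γ N T_L T_R s m z wp *ᵥ ratVec N a.1) /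
    (ratVec N a.1 ⬝ᵥ ratVec N a.1)

/-- **The level-`m` Gram floor** `F_m(z, wp) = inf` of the Rayleigh quotients of `Γ_m(z, wp)` over
the nonzero rational directions — the smallest eigenvalue `λ_min(Γ_m)`, written as a countable
infimum so that measurability in the path is elementary. [folklore] -/
def skelGramFloor (m : ℕ) (z : PhaseSpace N) (wp : WienerPair) : ℝ :=
  ⨅ a : RatDir N, skelRayleigh ω₂ lam β γ N T_L T_R s m z wp a

/-- **The limit floor** `L(z, wp) = sup_m (F_m(z, wp))⁺ ∈ [0, ∞]` — the monotone limit of the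
smallest eigenvalues of the increasing Gram matrices `Γ_m` (a lower bound for, and under the
identification of part (g3) equal to, `λ_min` of the Malliavin matrix at time `s`). [folklore] -/
def skelGramLimitFloor (z : PhaseSpace N) (wp : WienerPair) : ℝ≥0∞ :=
  ⨆ m : ℕ, ENNReal.ofReal (skelGramFloor ω₂ lam β γ N T_L T_R s m z wp)

variable {ω₂ lam β γ N T_L T_R s}

/-- `aᵀ Γ_m a ≥ 0` (a normalised sum of squares, part S). [folklore] -/
theorem dotProduct_skelGramPath_mulVec_nonneg (m : ℕ) (z : PhaseSpace N) (wp : WienerPair)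
    (g : Fin N ⊕ Fin N → ℝ) : 0 ≤ g ⬝ᵥ (skelGramPath ω₂ lam β γ N T_L T_R s m z wp *ᵥ g) := by
  rw [skelGramPath_eq, dotProduct_skelGramAt_mulVec]
  exact mul_nonneg (by positivity) (Finset.sum_nonneg fun j _ => sq_nonneg _)

/-- `skelRayleigh_nonneg` (docstring added by the landing lane; see the module docstring). [formal bookkeeping] -/
theorem skelRayleigh_nonneg (m : ℕ) (z : PhaseSpace N) (wp : WienerPair) (a : RatDir N) :
    0 ≤ skelRayleigh ω₂ lam β γ N T_L T_R s m z wp a :=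
  div_nonneg (dotProduct_skelGramPath_mulVec_nonneg m z wp _) (dotProduct_self_nonneg_real _)

/-- `skelGramFloor_nonneg` (docstring added by the landing lane; see the module docstring). [formal bookkeeping] -/
theorem skelGramFloor_nonneg (hN : 0 < N) (m : ℕ) (z : PhaseSpace N) (wp : WienerPair) :
    0 ≤ skelGramFloor ω₂ lam β γ N T_L T_R s m z wp :=
  have := nonempty_ratDir hN
  le_ciInf fun a => skelRayleigh_nonneg m z wp a

/-- **A frame constant is below the floor**: `Λ |a|² ≤ aᵀΓ_m a` for all `a` gives `Λ ≤ F_m`.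
[folklore] -/
theorem le_skelGramFloor (hN : 0 < N) (m : ℕ) (z : PhaseSpace N) (wp : WienerPair) {Λ : ℝ}
    (h : ∀ a : Fin N ⊕ Fin N → ℝ,
      Λ * (a ⬝ᵥ a) ≤ a ⬝ᵥ (skelGramPath ω₂ lam β γ N T_L T_R s m z wp *ᵥ a)) :
    Λ ≤ skelGramFloor ω₂ lam β γ N T_L T_R s m z wp :=
  have := nonempty_ratDir hN
  le_ciInf fun a => (le_div_iff₀ (ratVec_dotProduct_self_pos a)).2 (h _)

/-- **The floor is a frame constant**: `F_m |a|² ≤ aᵀΓ_m a` for EVERY real direction `a` (true at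
the dense rational directions by definition; both sides are continuous in `a`). [folklore] -/
theorem skelGramFloor_frame (m : ℕ) (z : PhaseSpace N) (wp : WienerPair) (a : Fin N ⊕ Fin N → ℝ) :
    skelGramFloor ω₂ lam β γ N T_L T_R s m z wp * (a ⬝ᵥ a) ≤
      a ⬝ᵥ (skelGramPath ω₂ lam β γ N T_L T_R s m z wp *ᵥ a) := by
  have hS : IsClosed {a : Fin N ⊕ Fin N → ℝ | skelGramFloor ω₂ lam β γ N T_L T_R s m z wp *
      (a ⬝ᵥ a) ≤ a ⬝ᵥ (skelGramPath ω₂ lam β γ N T_L T_R s m z wp *ᵥ a)} :=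
    isClosed_le (continuous_const.mul (continuous_id.dotProduct continuous_id))
      (continuous_id.dotProduct (continuous_const.matrix_mulVec continuous_id))
  have hsub : range (ratVec N) ⊆ {a : Fin N ⊕ Fin N → ℝ |
      skelGramFloor ω₂ lam β γ N T_L T_R s m z wp * (a ⬝ᵥ a) ≤
        a ⬝ᵥ (skelGramPath ω₂ lam β γ N T_L T_R s m z wp *ᵥ a)} := by
    rintro _ ⟨b, rfl⟩
    by_cases hb : b = 0
    · rw [hb, ratVec_zero]
      simp
    · have hbdd : BddBelow (range (skelRayleigh ω₂ lam β γ N T_L T_R s m z wp)) :=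
        ⟨0, by rintro _ ⟨a', rfl⟩; exact skelRayleigh_nonneg m z wp a'⟩
      exact (le_div_iff₀ (ratVec_dotProduct_self_pos ⟨b, hb⟩)).1 (ciInf_le hbdd ⟨b, hb⟩)
  have hmem : a ∈ closure {a : Fin N ⊕ Fin N → ℝ |
      skelGramFloor ω₂ lam β γ N T_L T_R s m z wp * (a ⬝ᵥ a) ≤
        a ⬝ᵥ (skelGramPath ω₂ lam β γ N T_L T_R s m z wp *ᵥ a)} := by
    rw [((denseRange_ratVec N).mono hsub).closure_eq]
    exact mem_univ a
  rw [hS.closure_eq] at hmem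
  exact hmem

/-- The floor is below the limit floor. [folklore] -/
theorem ofReal_skelGramFloor_le_limitFloor (m : ℕ) (z : PhaseSpace N) (wp : WienerPair) :
    ENNReal.ofReal (skelGramFloor ω₂ lam β γ N T_L T_R s m z wp) ≤
      skelGramLimitFloor ω₂ lam β γ N T_L T_R s z wp :=
  le_iSup (fun m => ENNReal.ofReal (skelGramFloor ω₂ lam β γ N T_L T_R s m z wp)) m

end Floor

section FloorMono

variable {ω₂ lam β γ : ℝ} (hω : 0 < ω₂) (hl : 0 ≤ lam) (hβ : 0 ≤ β) (hγ : 0 ≤ γ) (N : ℕ)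
  (T_L T_R : ℝ)

include hω hl hβ hγ

/-- **The floor increases with the level** (Loewner monotonicity of `Γ_m`, part S). [folklore] -/
theorem skelGramFloor_mono (hN : 0 < N) {s : ℝ} (hs : s ∈ Icc (0 : ℝ) 1) (z : PhaseSpace N)
    {m' m : ℕ} (hmm : m' ≤ m) (wp : WienerPair) :
    skelGramFloor ω₂ lam β γ N T_L T_R s m' z wp ≤ skelGramFloor ω₂ lam β γ N T_L T_R s m z wp :=
  le_skelGramFloor hN m z wp fun a => (skelGramFloor_frame m' z wp a).trans
    (dotProduct_skelGramPath_mulVec_mono hω hl hβ hγ N T_L T_R hs z wp a hmm)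

/-- **The floor is measurable in the path** (a countable infimum of measurable Rayleigh
quotients; entries of `Γ_m` measurable by part S'). [folklore] -/
theorem measurable_skelGramFloor {s : ℝ} (hs : s ∈ Icc (0 : ℝ) 1) (m : ℕ) (z : PhaseSpace N) :
    Measurable fun wp => skelGramFloor ω₂ lam β γ N T_L T_R s m z wp := by
  have hι : Measurable fun wp : WienerPair => (pairSkel m wp, pairRem m wp) :=
    (measurable_pairSkel m).prodMk (measurable_pairRem m)
  have hM : ∀ k l, Measurable fun wp : WienerPair =>
      skelGramPath ω₂ lam β γ N T_L T_R s m z wp k l := by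
    intro k l
    have h := (measurable_skelGramAt_apply hω hl hβ hγ N T_L T_R hs m z k l).comp hι
    exact h
  refine Measurable.iInf fun a => ?_
  have hv : ∀ k, Measurable fun _ : WienerPair => ratVec N a.1 k := fun _ => measurable_const
  exact (measurable_dotProduct_mulVec hM hv hv).div_const _

/-- The limit floor is measurable in the path. [folklore] -/
theorem measurable_skelGramLimitFloor {s : ℝ} (hs : s ∈ Icc (0 : ℝ) 1) (z : PhaseSpace N) :
    Measurable fun wp => skelGramLimitFloor ω₂ lam β γ N T_L T_R s z wp :=
  Measurable.iSup fun m => (measurable_skelGramFloor hω hl hβ hγ N T_L T_R hs m z).ennreal_ofReal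

end FloorMono

/-! ## 2. The limit currency (MC∞) -/

section Statement

/-- The body of **(MC∞)** at fixed chain parameters: inverse moments of the limit floor
`L(z, wp) = sup_m λ_min(Γ_m)⁺` with sub-exponential energy growth. [folklore] -/
def SkeletonGramLimitInverseMomentsBody (ω₂ lam β γ : ℝ) : Prop :=
  ∀ T : ℝ, 0 < T → ∀ N : ℕ, 2 ≤ N → ∀ q ε : ℝ, 0 < q → 0 < ε →
    ∃ δ₀ C : ℝ, 0 < δ₀ ∧ 0 ≤ C ∧
      ∀ δ : ℝ, |δ| < δ₀ → ∀ s : ℝ, 1 / 2 ≤ s → s ≤ 1 → ∀ z : PhaseSpace N,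
        ∫⁻ wp, (skelGramLimitFloor ω₂ lam β γ N (T + δ / 2) (T - δ / 2) s z wp)⁻¹ ^ q
            ∂wienerPair ≤
          ENNReal.ofReal ((C * Real.exp (ε * (pinnedChain ω₂ lam β γ).hamiltonian N z)) ^ q)

/-- **(MC∞) `SkeletonGramLimitInverseMoments`** — for the chain driven at both ends, at a FIXED
time `s ∈ [½, 1]`: the monotone limit `L = sup_m λ_min(Γ_m)⁺` of the smallest eigenvalues of the
skeleton Gram (compressed Malliavin) matrices has all inverse moments, the only energy dependence
being `e^{εH(z)}` (every `ε > 0`), uniformly in `|δ| < δ₀`: `E[L^{-q}] ≤ (C_q e^{εH(z)})^q`.  No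
level, no minorant, no regularisation in the statement.  Sandwiched (MC⁰) ⇒ (MC∞) ⇒ (MC⁰_κ)
(§3); decided for the harmonic chain; the load-bearing input in general is Hörmander's bracket
condition for the chain (`V'' ≥ 1`) + the Norris / Kusuoka–Stroock inverse-moment bound for the
Malliavin matrix with Lyapunov control `e^{εH}` of the growth (Hairer–Mattingly 2011, Thm 6.7
shape), after identifying `L` with its smallest eigenvalue.
[NEW · the proposed binder beneath (MD₂) · ATTACKABLE-XL]
(after Nualart2006, §2.3 Lemma 2.3.1) (after HairerMattingly2011spde, Thm 6.7) [route leaf · named hypothesis of this cell, NOT filed as a route item here] -/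
def SkeletonGramLimitInverseMoments : Prop :=
  ∀ ω₂ lam β γ : ℝ, 0 < ω₂ → 0 < lam → 0 < β → 0 < γ →
    SkeletonGramLimitInverseMomentsBody ω₂ lam β γ

/-- (MC∞) is, by definition, its body at all positive parameters. [folklore] -/
theorem skeletonGramLimitInverseMoments_iff :
    SkeletonGramLimitInverseMoments ↔
      ∀ ω₂ lam β γ : ℝ, 0 < ω₂ → 0 < lam → 0 < β → 0 < γ →
        SkeletonGramLimitInverseMomentsBody ω₂ lam β γ :=
  Iff.rfl

end Statement

/-! ## 3. The sandwich (MC⁰) ⇒ (MC∞) ⇒ (MC⁰_κ) -/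

section Sandwich

variable {ω₂ lam β γ : ℝ}

/-- **(MC⁰) ⇒ (MC∞)** at fixed parameters (same `δ₀, C`): a frame minorant `Λ` serving the level
`m₁` is below `F_{m₁} ≤ L`, so `L^{-q} ≤ Λ^{-q}` pointwise. [folklore] -/
theorem skeletonGramLimitInverseMomentsBody_of_body
    (h : SkeletonGramInverseMomentsBody ω₂ lam β γ) :
    SkeletonGramLimitInverseMomentsBody ω₂ lam β γ := by
  intro T hT N hN q ε hq hε
  obtain ⟨δ₀, C, hδ₀, hC, hmain⟩ := h T hT N hN q ε hq hε
  refine ⟨δ₀, C, hδ₀, hC, fun δ hδ s hs hs1 z => ?_⟩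
  obtain ⟨m₁, Λ, -, hframe, hint⟩ := hmain δ hδ s hs hs1 z
  refine le_trans (lintegral_mono fun wp => ?_) hint
  exact ENNReal.rpow_le_rpow (ENNReal.inv_le_inv.2
    ((ENNReal.ofReal_le_ofReal (le_skelGramFloor (by omega) m₁ z wp (hframe m₁ le_rfl wp))).trans
      (ofReal_skelGramFloor_le_limitFloor m₁ z wp))) hq.le

/-- **(MC∞) ⇒ (MC⁰_κ)** at fixed parameters, with constant `C + 1` (dominated convergence
`lintegral_iInf` for the decreasing functions `(F_m + κ)^{-q} ≤ κ^{-q}`, whose infimum is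
`(sup_m (F_m + κ))^{-q} ≤ L^{-q}`; then `Λ = F_{m₁} + κ` at the level found). [folklore] -/
theorem skeletonGramInverseMomentsRegBody_of_limit (hω : 0 < ω₂) (hl : 0 ≤ lam) (hβ : 0 ≤ β)
    (hγ : 0 ≤ γ) (h : SkeletonGramLimitInverseMomentsBody ω₂ lam β γ) :
    SkeletonGramInverseMomentsRegBody ω₂ lam β γ := by
  intro T hT N hN q ε hq hε
  obtain ⟨δ₀, C, hδ₀, hC, hmain⟩ := h T hT N hN q ε hq hε
  refine ⟨δ₀, C + 1, hδ₀, by positivity, fun δ hδ s hs hs1 z κ hκ => ?_⟩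
  have hN0 : 0 < N := by omega
  have hs' : s ∈ Icc (0 : ℝ) 1 := ⟨by linarith, hs1⟩
  set F : ℕ → WienerPair → ℝ := fun n wp =>
    skelGramFloor ω₂ lam β γ N (T + δ / 2) (T - δ / 2) s n z wp with hF
  set f : ℕ → WienerPair → ℝ≥0∞ := fun n wp => (ENNReal.ofReal (F n wp + κ))⁻¹ ^ q with hf
  have hFmeas : ∀ n, Measurable (F n) := fun n =>
    measurable_skelGramFloor hω hl hβ hγ N (T + δ / 2) (T - δ / 2) hs' n z
  have hfmeas : ∀ n, Measurable (f n) := fun n =>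
    ((hFmeas n).add_const κ).ennreal_ofReal.inv.pow_const q
  have hFmono : ∀ {n n' : ℕ}, n ≤ n' → ∀ wp, F n wp ≤ F n' wp := fun hnn' wp =>
    skelGramFloor_mono hω hl hβ hγ N (T + δ / 2) (T - δ / 2) hN0 hs' z hnn' wp
  have hfanti : Antitone f := fun n n' hnn' wp =>
    ENNReal.rpow_le_rpow (ENNReal.inv_le_inv.2
      (ENNReal.ofReal_le_ofReal (by linarith [hFmono hnn' wp]))) hq.le
  -- domination at level 0 by the constant `κ^{-q}`
  have hf0 : ∫⁻ wp, f 0 wp ∂wienerPair ≠ ⊤ := by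
    refine ne_top_of_le_ne_top ?_ (lintegral_mono fun wp => ?_ :
      ∫⁻ wp, f 0 wp ∂wienerPair ≤ ∫⁻ _ : WienerPair, (ENNReal.ofReal κ)⁻¹ ^ q ∂wienerPair)
    · rw [lintegral_const, measure_univ, mul_one]
      exact (ENNReal.rpow_lt_top_of_nonneg hq.le
        (ENNReal.inv_ne_top.2 (ENNReal.ofReal_pos.2 hκ).ne')).ne
    · exact ENNReal.rpow_le_rpow (ENNReal.inv_le_inv.2 (ENNReal.ofReal_le_ofReal
        (le_add_of_nonneg_left (skelGramFloor_nonneg hN0 0 z wp)))) hq.le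
  -- the infimum of the `f n` is below `L^{-q}` pointwise
  have hptw : ∀ wp, ⨅ n, f n wp ≤
      (skelGramLimitFloor ω₂ lam β γ N (T + δ / 2) (T - δ / 2) s z wp)⁻¹ ^ q := by
    intro wp
    have h2 := (ENNReal.orderIsoRpow q hq).map_iInf fun n => (ENNReal.ofReal (F n wp + κ))⁻¹
    simp only [ENNReal.orderIsoRpow_apply] at h2
    calc ⨅ n, f n wp = (⨅ n, (ENNReal.ofReal (F n wp + κ))⁻¹) ^ q := h2.symm
      _ = (⨆ n, ENNReal.ofReal (F n wp + κ))⁻¹ ^ q := by rw [ENNReal.inv_iSup]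
      _ ≤ (skelGramLimitFloor ω₂ lam β γ N (T + δ / 2) (T - δ / 2) s z wp)⁻¹ ^ q :=
          ENNReal.rpow_le_rpow (ENNReal.inv_le_inv.2 (iSup_mono fun n =>
            ENNReal.ofReal_le_ofReal (le_add_of_nonneg_right hκ.le))) hq.le
  -- dominated convergence and strict room `C < C + 1`
  have hB : ∫⁻ wp, ⨅ n, f n wp ∂wienerPair <
      ENNReal.ofReal (((C + 1) * Real.exp (ε * (pinnedChain ω₂ lam β γ).hamiltonian N z)) ^ q) := by
    refine lt_of_le_of_lt ((lintegral_mono hptw).trans (hmain δ hδ s hs hs1 z)) ?_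
    rw [ENNReal.ofReal_lt_ofReal_iff (by positivity)]
    exact Real.rpow_lt_rpow (by positivity)
      (mul_lt_mul_of_pos_right (lt_add_one C) (Real.exp_pos _)) hq
  rw [lintegral_iInf hfmeas hfanti hf0, iInf_lt_iff] at hB
  obtain ⟨m₁, hm₁⟩ := hB
  refine ⟨m₁, fun wp => F m₁ wp + κ, (hFmeas m₁).add_const κ, fun m hm wp a => ?_, hm₁.le⟩
  refine frameBound_reg_mono hω hl hβ hγ N (T + δ / 2) (T - δ / 2) hs' z hm κ
    (Λ := fun wp => F m₁ wp + κ) (fun wp a => ?_) wp a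
  rw [dotProduct_add_smul_one_mulVec, add_mul]
  exact add_le_add (skelGramFloor_frame m₁ z wp a) le_rfl

/-- **(MC⁰) ⇒ (MC∞).** [folklore] -/
theorem skeletonGramLimitInverseMoments_of_skeletonGramInverseMoments
    (h : SkeletonGramInverseMoments) : SkeletonGramLimitInverseMoments :=
  fun ω₂ lam β γ hω hl hβ hγ =>
    skeletonGramLimitInverseMomentsBody_of_body (h ω₂ lam β γ hω hl hβ hγ)

/-- **(MC∞) ⇒ (MC⁰_κ).** [folklore] -/
theorem skeletonGramInverseMomentsReg_of_skeletonGramLimitInverseMoments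
    (h : SkeletonGramLimitInverseMoments) : SkeletonGramInverseMomentsReg :=
  fun ω₂ lam β γ hω hl hβ hγ =>
    skeletonGramInverseMomentsRegBody_of_limit hω hl.le hβ.le hγ.le (h ω₂ lam β γ hω hl hβ hγ)

/-- **HARMONIC CALIBRATION of (MC∞)** (from part A's calibration of (MC⁰)). [folklore] -/
theorem harmonic_skeletonGramLimitInverseMomentsBody (hω : 0 < ω₂) (hγ : 0 < γ) :
    SkeletonGramLimitInverseMomentsBody ω₂ 0 0 γ :=
  skeletonGramLimitInverseMomentsBody_of_body (harmonic_skeletonGramInverseMomentsBody hω hγ)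

end Sandwich

end Summit.AtomisticToContinuum.FouriersLaw.Theorems.ExtensiveSnapshotIrreversibility.EnergyWindow
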